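import Literature.Algebra.Bialgebra.DegreeTwoCupSurjectiveOfKunneth
import Literature.Algebra.Homology.OrderedCechSystemCupClasses
import Literature.Algebra.Homology.OrderedCechSystemRefineMap
import Literature.Algebra.Homology.OrderedCechSystemRefineComp
import Literature.Algebra.Homology.OrderedCechSystemRefineConst
import Literature.Algebra.Homology.KunnethComponentsBookkeeping
import Literature.AlgebraicGeometry.Modules.CechUnitModulePairing
import Literature.AlgebraicGeometry.Modules.CechUnitModuleHZeroScalars
import Literature.AlgebraicGeometry.Modules.CechPullbackSystemHom
import Literature.AlgebraicGeometry.Modules.CechRefineMultiplicative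
import Literature.AlgebraicGeometry.Modules.CechRefineClasses
import Literature.AlgebraicGeometry.Modules.CechOrderedRefinementComparison
import Literature.AlgebraicGeometry.Modules.CechCupGradedCommutative
import Literature.AlgebraicGeometry.Modules.LinearOverBase
import Literature.AlgebraicGeometry.Morphisms.ProductAffineCover
import Literature.AlgebraicGeometry.AbelianSchemes.AbelianSchemeProductCoverIndexMaps
import Literature.AlgebraicGeometry.AbelianSchemes.AbelianSchemeSteinOfArtinian
import HarnessLib

/-!
# The Čech classes of `𝒪` on an abelian variety and on its square: the seven structure maps `m^*, p₁^*, p₂^*, sw^*, i₁^*, i₂^*`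
# and the refinement `r^*` (Mumford AV §13), their multiplicativity and units

Layer `Literature/AlgebraicGeometry/AbelianSchemes`; namespace `Literature.AlgebraicGeometry.AbelianSchemes.AbelianVarietyCech`.  For an
abelian variety `A` over a field `k` (`A : AbelianSchemeOver (Spec k)`), a finite affine open cover `U` of `A`, the PRODUCT cover
`W₀ (i, j) = p₁⁻¹ U_i ∩ p₂⁻¹ U_j` of `A × A` and its refinement `W ((i,j),l) = W₀(i,j) ∩ m⁻¹ U_l` (covers as BINDERS with their
shapes `hW₀`, `hW`, ★ `Morphisms/ProductAffineCover` constructs them), this file NAMES (reducible abbreviations, no new mathematics):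
the ordered module Čech complexes `CA = Č(U, 𝒪_A)`, `CS = Č(W₀, 𝒪_{A×A})`, `CT = Č(W, 𝒪_{A×A})` over the base rings
`ρ₁ = scalarRingHomTop A.X`, `ρ₂` (★ `Modules/LinearOverBase`), their cup products `cupA cupS cupT` (★ `cupH` of ★ `mulPairing`), the
system morphisms `φ_{p₁} … φ_{i₂}` (★ `Modules.pullbackSystemHom` with the admissible index maps of ★ `AbelianSchemeProductCoverIndexMaps`)
and the induced maps on classes `pOne pTwo mT rT swS iOne iTwo` (★ `refineComplexMap`), `mS := (rT)⁻¹ ∘ mT` — and PROVES: the Leray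
hypotheses of the three covers (★ `isAffineOpen_cechOpen_of_nonempty`), `r^*` bijective (★ (G5-c) `homologyMap_refineComplexMap_pullbackSystemHom_id_bijective`),
all seven maps MULTIPLICATIVE on classes (monotone index maps by ★ `homologyMap_refineComplexMap_cupH`, the others by ★
`Modules/CechRefineMultiplicative.homologyMap_cupH`) and UNITAL (★ `homologyMap_refineComplexMap_unit`).  These are the hypotheses
`hm_mul … hi₂_mul`, `hp₁_one hp₂_one hm_one` of the bialgebra assembly ★ `cup_one_one_surjective` for `Ȟ•(A, 𝒪)`; the composites,
Künneth and the conclusion `Ȟ¹ ⊗ Ȟ¹ ↠ Ȟ²` are the sequels `AbelianVarietyCechProductComposites`, `AbelianVarietyCechCupSurjective`.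
[cite: MumfordAV1970, §13 Cor. 2 (p. 129)] [cite: StacksProject, Tag 01FP] [cite: Godement1958, II §6.6]
-/

noncomputable section

open CategoryTheory CategoryTheory.Limits CategoryTheory.MonoidalCategory AlgebraicGeometry TopologicalSpace Opposite
open HomologicalComplex TensorProduct Finset
open Literature.Algebra.Homology Literature.Algebra.Homology.OrderedCech Literature.AlgebraicGeometry.Modules
open Literature.AlgebraicGeometry.Morphisms

set_option backward.isDefEq.respectTransparency false

namespace Literature.AlgebraicGeometry.AbelianSchemes.AbelianVarietyCech

universe u

/-! ## §1 (G5) The setting — an abelian variety, a finite affine cover, the product, its two covers (as BINDERS) -/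

section Setting

variable {k : Type} [Field k] (A : AbelianSchemeOver (Spec (.of k)))
  {ι : Type} [LinearOrder ι] [Fintype ι] (U : ι → A.X.left.affineOpens)

/-- The cover as a family of opens. [cite: MumfordAV1970, §13 Cor. 2 (p. 129)] -/
abbrev U' : ι → A.X.left.Opens := fun i => (U i).1

/-- `X × X` as the scheme underlying `A.X ⊗ A.X` (`= pullback X.hom X.hom`). [cite: MumfordAV1970, §13 Cor. 2 (p. 129)] -/
abbrev X2 : Scheme := (A.X ⊗ A.X).left

/-- `p₁ : X × X → X`. [cite: MumfordAV1970, §13 Cor. 2 (p. 129)] -/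
abbrev p₁ : X2 A ⟶ A.X.left := (CartesianMonoidalCategory.fst A.X A.X).left
/-- `p₂ : X × X → X`. [cite: MumfordAV1970, §13 Cor. 2 (p. 129)] -/
abbrev p₂ : X2 A ⟶ A.X.left := (CartesianMonoidalCategory.snd A.X A.X).left
/-- the group law `m : X × X → X`. [cite: MumfordAV1970, §13 Cor. 2 (p. 129)] -/
abbrev m : X2 A ⟶ A.X.left := (MonObj.mul : A.X ⊗ A.X ⟶ A.X).left
/-- the swap `sw : X × X → X × X`. [cite: MumfordAV1970, §13 Cor. 2 (p. 129)] -/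
abbrev sw : X2 A ⟶ X2 A := ((β_ A.X A.X).hom).left
/-- the slice `i₁ = (id, e) : X → X × X`. [cite: MumfordAV1970, §13 Cor. 2 (p. 129)] -/
abbrev i₁ : A.X.left ⟶ X2 A := ((ρ_ A.X).inv ≫ A.X ◁ (MonObj.one : 𝟙_ _ ⟶ A.X)).left
/-- the slice `i₂ = (e, id) : X → X × X`. [cite: MumfordAV1970, §13 Cor. 2 (p. 129)] -/
abbrev i₂ : A.X.left ⟶ X2 A := ((λ_ A.X).inv ≫ (MonObj.one : 𝟙_ _ ⟶ A.X) ▷ A.X).left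
/-- the identity point `e : Spec k → X`. [cite: MumfordAV1970, §13 Cor. 2 (p. 129)] -/
abbrev e : (𝟙_ (Over (Spec (.of k)))).left ⟶ A.X.left := (MonObj.one : 𝟙_ _ ⟶ A.X).left

/-- base ring of `X`: `k → Γ(X, 𝒪)`. [cite: MumfordAV1970, §13 Cor. 2 (p. 129)] -/
abbrev ρ₁ : k →+* Γ(A.X.left, ⊤) := scalarRingHomTop A.X
/-- base ring of `X × X`. [cite: MumfordAV1970, §13 Cor. 2 (p. 129)] -/
abbrev ρ₂ : k →+* Γ(X2 A, ⊤) := scalarRingHomTop (A.X ⊗ A.X)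

/-- Base rings along an `Over`-morphism: `ρ_Y a = g^♯ (ρ_X a)`. [cite: MumfordAV1970, §13 Cor. 2 (p. 129)] -/
theorem scalarRingHomTop_over {X Y : Over (Spec (.of k))} (g : Y ⟶ X) (a : k) :
    scalarRingHomTop Y a = g.left.appTop (scalarRingHomTop X a) := by
  rw [scalarRingHomTop_apply, scalarRingHomTop_apply, ← Over.w g, Scheme.Hom.comp_appTop]
  rfl

/-- Base rings along `p₁`. [folklore] [cite: StacksProject, Tag 01FG] -/
theorem hρ_p₁ (a : k) : ρ₂ A a = (p₁ A).appTop (ρ₁ A a) := scalarRingHomTop_over (CartesianMonoidalCategory.fst A.X A.X) a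
/-- Base rings along `p₂`. [folklore] [cite: StacksProject, Tag 01FG] -/
theorem hρ_p₂ (a : k) : ρ₂ A a = (p₂ A).appTop (ρ₁ A a) := scalarRingHomTop_over (CartesianMonoidalCategory.snd A.X A.X) a
/-- Base rings along `m`. [folklore] [cite: StacksProject, Tag 01FG] -/
theorem hρ_m (a : k) : ρ₂ A a = (m A).appTop (ρ₁ A a) := scalarRingHomTop_over (MonObj.mul : A.X ⊗ A.X ⟶ A.X) a
/-- Base rings along `sw`. [folklore] [cite: StacksProject, Tag 01FG] -/
theorem hρ_sw (a : k) : ρ₂ A a = (sw A).appTop (ρ₂ A a) := scalarRingHomTop_over ((β_ A.X A.X).hom) a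
/-- Base rings along `i₁`. [folklore] [cite: StacksProject, Tag 01FG] -/
theorem hρ_i₁ (a : k) : ρ₁ A a = (i₁ A).appTop (ρ₂ A a) :=
  scalarRingHomTop_over ((ρ_ A.X).inv ≫ A.X ◁ (MonObj.one : 𝟙_ _ ⟶ A.X)) a
/-- Base rings along `i₂`. [folklore] [cite: StacksProject, Tag 01FG] -/
theorem hρ_i₂ (a : k) : ρ₁ A a = (i₂ A).appTop (ρ₂ A a) :=
  scalarRingHomTop_over ((λ_ A.X).inv ≫ (MonObj.one : 𝟙_ _ ⟶ A.X) ▷ A.X) a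
/-- Base rings along `𝟙`. [folklore] [cite: StacksProject, Tag 01FG] -/
theorem hρ_r (a : k) : ρ₂ A a = (𝟙 (X2 A) : X2 A ⟶ X2 A).appTop (ρ₂ A a) := by simp

variable (W₀ : ι ×ₗ ι → (X2 A).affineOpens)
  (hW₀ : ∀ i j, (W₀ (toLex (i, j))).1 = p₁ A ⁻¹ᵁ (U i).1 ⊓ p₂ A ⁻¹ᵁ (U j).1)
  (W : (ι ×ₗ ι) ×ₗ ι → (X2 A).affineOpens)
  (hW : ∀ c l, (W (toLex (c, l))).1 = (W₀ c).1 ⊓ m A ⁻¹ᵁ (U l).1)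
  (j₀ : ι) (hj₀ : e A ⁻¹ᵁ (U j₀).1 = ⊤)

/-- The product cover as a family of opens. [cite: MumfordAV1970, §13 Cor. 2 (p. 129)] -/
abbrev W₀' : ι ×ₗ ι → (X2 A).Opens := fun c => (W₀ c).1
/-- The triple cover as a family of opens. [cite: MumfordAV1970, §13 Cor. 2 (p. 129)] -/
abbrev W' : (ι ×ₗ ι) ×ₗ ι → (X2 A).Opens := fun d => (W d).1

/-! ### The graded pieces and the cup products -/

/-- `Č(U, 𝒪_X)`. [cite: MumfordAV1970, §13 Cor. 2 (p. 129)] -/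
abbrev CA := cechComplex (U' A U) (unitModule A.X.left) (ρ₁ A)
/-- `Č(W₀, 𝒪_{X×X})` (product cover). [cite: MumfordAV1970, §13 Cor. 2 (p. 129)] -/
abbrev CS := cechComplex (W₀' A W₀) (unitModule (X2 A)) (ρ₂ A)
/-- `Č(W, 𝒪_{X×X})` (triple cover, only for `m^*`). [cite: MumfordAV1970, §13 Cor. 2 (p. 129)] -/
abbrev CT := cechComplex (W' A W) (unitModule (X2 A)) (ρ₂ A)

/-- cup product on `Ȟ(U, 𝒪_X)`. [cite: MumfordAV1970, §13 Cor. 2 (p. 129)] -/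
abbrev cupA (a b n : ℕ) (h : a + b = n) :=
  cupH (mulPairing (U' A U) (ρ₁ A)) (isNaturalPairing_mulPairing _ _) a b n h
/-- cup product on `Ȟ(W₀, 𝒪_{X×X})`. [cite: MumfordAV1970, §13 Cor. 2 (p. 129)] -/
abbrev cupS (a b n : ℕ) (h : a + b = n) :=
  cupH (mulPairing (W₀' A W₀) (ρ₂ A)) (isNaturalPairing_mulPairing _ _) a b n h
/-- cup product on `Ȟ(W, 𝒪_{X×X})`. [cite: MumfordAV1970, §13 Cor. 2 (p. 129)] -/
abbrev cupT (a b n : ℕ) (h : a + b = n) :=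
  cupH (mulPairing (W' A W) (ρ₂ A)) (isNaturalPairing_mulPairing _ _) a b n h

/-! ### The system morphisms of the seven maps (★ `Modules.pullbackSystemHom`, admissibility ★ B-p20) -/

/-- `φ_{p₁}`. [cite: MumfordAV1970, §13 Cor. 2 (p. 129)] -/
abbrev φp₁ := pullbackSystemHom (p₁ A) (U' A U) (W₀' A W₀) (fun c => (ofLex c).1)
  (AbelianSchemeOver.productCover_le_preimage_fst A (U' A U) (W₀' A W₀) hW₀) (ρ₁ A) (ρ₂ A) (hρ_p₁ A)
/-- `φ_{p₂}`. [cite: MumfordAV1970, §13 Cor. 2 (p. 129)] -/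
abbrev φp₂ := pullbackSystemHom (p₂ A) (U' A U) (W₀' A W₀) (fun c => (ofLex c).2)
  (AbelianSchemeOver.productCover_le_preimage_snd A (U' A U) (W₀' A W₀) hW₀) (ρ₁ A) (ρ₂ A) (hρ_p₂ A)
/-- `φ_m` (into the triple cover). [cite: MumfordAV1970, §13 Cor. 2 (p. 129)] -/
abbrev φm := pullbackSystemHom (m A) (U' A U) (W' A W) (fun d => (ofLex d).2)
  (AbelianSchemeOver.refinedCover_le_preimage_mul A (U' A U) (W₀' A W₀) (W' A W) hW) (ρ₁ A) (ρ₂ A) (hρ_m A)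
/-- `φ_r` (refinement `W → W₀` along `𝟙`). [cite: MumfordAV1970, §13 Cor. 2 (p. 129)] -/
abbrev φr := pullbackSystemHom (𝟙 (X2 A)) (W₀' A W₀) (W' A W) (fun d => (ofLex d).1)
  (AbelianSchemeOver.refinedCover_le_productCover A (U' A U) (W₀' A W₀) (W' A W) hW) (ρ₂ A) (ρ₂ A) (hρ_r A)
/-- `φ_{sw}`. [cite: MumfordAV1970, §13 Cor. 2 (p. 129)] -/
abbrev φsw := pullbackSystemHom (sw A) (W₀' A W₀) (W₀' A W₀) (fun c => toLex ((ofLex c).2, (ofLex c).1))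
  (AbelianSchemeOver.productCover_le_preimage_braiding A (U' A U) (W₀' A W₀) hW₀) (ρ₂ A) (ρ₂ A) (hρ_sw A)
/-- `φ_{i₁}`. [cite: MumfordAV1970, §13 Cor. 2 (p. 129)] -/
abbrev φi₁ := pullbackSystemHom (i₁ A) (W₀' A W₀) (U' A U) (fun i => toLex (i, j₀))
  (AbelianSchemeOver.le_preimage_unitLeft_productCover A (U' A U) (W₀' A W₀) hW₀ j₀ hj₀) (ρ₂ A) (ρ₁ A) (hρ_i₁ A)
/-- `φ_{i₂}`. [cite: MumfordAV1970, §13 Cor. 2 (p. 129)] -/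
abbrev φi₂ := pullbackSystemHom (i₂ A) (W₀' A W₀) (U' A U) (fun i => toLex (j₀, i))
  (AbelianSchemeOver.le_preimage_unitRight_productCover A (U' A U) (W₀' A W₀) hW₀ j₀ hj₀) (ρ₂ A) (ρ₁ A) (hρ_i₂ A)

/-! ### The maps on classes -/

/-- `p₁^*`. [cite: MumfordAV1970, §13 Cor. 2 (p. 129)] -/
abbrev pOne (n : ℕ) : (CA A U).homology (n : ℤ) →ₗ[k] (CS A W₀).homology (n : ℤ) :=
  (HomologicalComplex.homologyMap (refineComplexMap (fun c => (ofLex c).1) (φp₁ A U W₀ hW₀)) (n : ℤ)).hom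
/-- `p₂^*`. [cite: MumfordAV1970, §13 Cor. 2 (p. 129)] -/
abbrev pTwo (n : ℕ) : (CA A U).homology (n : ℤ) →ₗ[k] (CS A W₀).homology (n : ℤ) :=
  (HomologicalComplex.homologyMap (refineComplexMap (fun c => (ofLex c).2) (φp₂ A U W₀ hW₀)) (n : ℤ)).hom
/-- `m^*` into the TRIPLE cover. [cite: MumfordAV1970, §13 Cor. 2 (p. 129)] -/
abbrev mT (n : ℕ) : (CA A U).homology (n : ℤ) →ₗ[k] (CT A W).homology (n : ℤ) :=
  (HomologicalComplex.homologyMap (refineComplexMap (fun d => (ofLex d).2) (φm A U W₀ W hW)) (n : ℤ)).hom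
/-- `r^* : Ȟ(W₀) → Ȟ(W)`. [cite: MumfordAV1970, §13 Cor. 2 (p. 129)] -/
abbrev rT (n : ℕ) : (CS A W₀).homology (n : ℤ) →ₗ[k] (CT A W).homology (n : ℤ) :=
  (HomologicalComplex.homologyMap (refineComplexMap (fun d => (ofLex d).1) (φr A U W₀ W hW)) (n : ℤ)).hom
/-- `sw^*`. [cite: MumfordAV1970, §13 Cor. 2 (p. 129)] -/
abbrev swS (n : ℕ) : (CS A W₀).homology (n : ℤ) →ₗ[k] (CS A W₀).homology (n : ℤ) :=
  (HomologicalComplex.homologyMap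
    (refineComplexMap (fun c => toLex ((ofLex c).2, (ofLex c).1)) (φsw A U W₀ hW₀)) (n : ℤ)).hom
/-- `i₁^*`. [cite: MumfordAV1970, §13 Cor. 2 (p. 129)] -/
abbrev iOne (n : ℕ) : (CS A W₀).homology (n : ℤ) →ₗ[k] (CA A U).homology (n : ℤ) :=
  (HomologicalComplex.homologyMap (refineComplexMap (fun i => toLex (i, j₀)) (φi₁ A U W₀ hW₀ j₀ hj₀)) (n : ℤ)).hom
/-- `i₂^*`. [cite: MumfordAV1970, §13 Cor. 2 (p. 129)] -/
abbrev iTwo (n : ℕ) : (CS A W₀).homology (n : ℤ) →ₗ[k] (CA A U).homology (n : ℤ) :=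
  (HomologicalComplex.homologyMap (refineComplexMap (fun i => toLex (j₀, i)) (φi₂ A U W₀ hW₀ j₀ hj₀)) (n : ℤ)).hom

end Setting


/-! ## §2 Leray hypotheses, `r^*` bijective, multiplicativity and units -/

section Assembly

variable {k : Type} [Field k] (A : AbelianSchemeOver (Spec (.of k)))
  {ι : Type} [LinearOrder ι] [Fintype ι] (U : ι → A.X.left.affineOpens) (hcov : ⨆ i, (U i).1 = ⊤)
  (W₀ : ι ×ₗ ι → (X2 A).affineOpens)
  (hW₀ : ∀ i j, (W₀ (toLex (i, j))).1 = p₁ A ⁻¹ᵁ (U i).1 ⊓ p₂ A ⁻¹ᵁ (U j).1)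
  (W : (ι ×ₗ ι) ×ₗ ι → (X2 A).affineOpens)
  (hW : ∀ c l, (W (toLex (c, l))).1 = (W₀ c).1 ⊓ m A ⁻¹ᵁ (U l).1)
  (j₀ : ι) (hj₀ : e A ⁻¹ᵁ (U j₀).1 = ⊤)

/-! ### Leray hypotheses of the three covers (★ B-p21) -/

omit [LinearOrder ι] [Fintype ι] in
/-- An abelian variety is separated. [cite: MumfordFogartyKirwan1994, Ch. 6 §1 Definition 6.1 (p. 115)] -/
theorem isSeparated_X : A.X.left.IsSeparated := by
  haveI : IsSeparated A.X.hom := A.isProper.toIsSeparated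
  -- `X → Spec k` separated and `Spec k` separated
  exact ⟨by rw [← terminal.comp_from A.X.hom]; infer_instance⟩

omit [LinearOrder ι] [Fintype ι] in
/-- `A × A` is separated. [cite: MumfordFogartyKirwan1994, Ch. 6 §1 Definition 6.1 (p. 115)] -/
theorem isSeparated_X2 : (X2 A).IsSeparated := by
  haveI : IsSeparated A.X.hom := A.isProper.toIsSeparated
  exact isSeparated_tensorObj_left (X := A.X) (Y := A.X)

omit [LinearOrder ι] [Fintype ι] in
/-- Finite intersections of `U` are affine. [cite: GortzWedhorn2023, Thm. 22.9 (p. 236)] -/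
theorem hUa : ∀ s : Finset ι, s.Nonempty → IsAffineOpen (cechOpen (U' A U) s) := fun s hs => by
  haveI := isSeparated_X A
  exact isAffineOpen_cechOpen_of_nonempty U hs

omit [LinearOrder ι] [Fintype ι] in
/-- Finite intersections of `W₀` are affine. [cite: GortzWedhorn2023, Thm. 22.9 (p. 236)] -/
theorem hW₀a : ∀ s : Finset (ι ×ₗ ι), s.Nonempty → IsAffineOpen (cechOpen (W₀' A W₀) s) := fun s hs => by
  haveI := isSeparated_X2 A
  exact isAffineOpen_cechOpen_of_nonempty W₀ hs

omit [LinearOrder ι] [Fintype ι] in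
/-- Finite intersections of `W` are affine. [cite: GortzWedhorn2023, Thm. 22.9 (p. 236)] -/
theorem hWa : ∀ s : Finset ((ι ×ₗ ι) ×ₗ ι), s.Nonempty → IsAffineOpen (cechOpen (W' A W) s) := fun s hs => by
  haveI := isSeparated_X2 A
  exact isAffineOpen_cechOpen_of_nonempty W hs

omit [LinearOrder ι] [Fintype ι] in
include hcov hW₀ in
/-- `W₀` covers `A × A`. [cite: StacksProject, Tag 0BEC] -/
theorem hW₀cov : ⨆ c, (W₀ c).1 = ⊤ := iSup_productCover_eq_top W₀ hW₀ hcov hcov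

omit [LinearOrder ι] [Fintype ι] in
include hcov hW₀ hW in
/-- `W` covers `A × A`. [cite: StacksProject, Tag 01FG] -/
theorem hWcov : ⨆ d, (W d).1 = ⊤ :=
  iSup_tripleCover_eq_top W₀ (m A) U W hW (hW₀cov A U hcov W₀ hW₀) hcov

/-! ### (G5-c) the refinement is bijective (★ `Modules/CechOrderedRefinementComparison`) -/

include hcov hW₀ hW in
/-- **`r^* : Ȟⁿ(W₀, 𝒪) → Ȟⁿ(W, 𝒪)` is bijective** (two affine covers with affine finite intersections of the separated `A × A`).
[cite: StacksProject, Tag 01XD] [cite: Hartshorne1977, III Thm. 4.5] -/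
theorem rT_bijective (n : ℕ) : Function.Bijective (rT A U W₀ W hW n) := by
  haveI : Fintype (ι ×ₗ ι) := inferInstanceAs (Fintype (ι × ι))
  haveI : Fintype ((ι ×ₗ ι) ×ₗ ι) := inferInstanceAs (Fintype ((ι ×ₗ ι) × ι))
  exact homologyMap_refineComplexMap_pullbackSystemHom_id_bijective (W₀' A W₀) (W' A W) (ρ₂ A) (fun d => (ofLex d).1)
    (AbelianSchemeOver.refinedCover_le_productCover A (U' A U) (W₀' A W₀) (W' A W) hW) (hρ_r A) (hW₀a A W₀) (hWa A W)
    (hW₀cov A U hcov W₀ hW₀) (hWcov A U hcov W₀ hW₀ W hW) (n : ℤ)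

/-- `m^* := (r^*)⁻¹ ∘ m_T^*`. [cite: MumfordAV1970, §13 Cor. 2 (p. 129)] -/
abbrev mS (n : ℕ) : (CA A U).homology (n : ℤ) →ₗ[k] (CS A W₀).homology (n : ℤ) :=
  (LinearEquiv.ofBijective (rT A U W₀ W hW n) (rT_bijective A U hcov W₀ hW₀ W hW n)).symm.toLinearMap ∘ₗ
    mT A U W₀ W hW n

/-! ### (G1-a) multiplicativity -/

omit [Fintype ι] in
/-- `p₁^*` is multiplicative. [cite: MumfordAV1970, §13 Cor. 2 (p. 129)] -/
theorem pOne_mul (a b n : ℕ) (h : a + b = n) (y : (CA A U).homology (a : ℤ)) (z : (CA A U).homology (b : ℤ)) :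
    pOne A U W₀ hW₀ n (cupA A U a b n h y z) = cupS A W₀ a b n h (pOne A U W₀ hW₀ a y) (pOne A U W₀ hW₀ b z) :=
  homologyMap_refineComplexMap_cupH _ _ _ _ (AbelianSchemeOver.monotone_indexMap_fst) _ _
    (pullbackSystemHom_mulPairing _ _ _ _ _ _ _ _) a b n h y z

omit [Fintype ι] in
/-- `r^*` is multiplicative. [cite: MumfordAV1970, §13 Cor. 2 (p. 129)] -/
theorem rT_mul (a b n : ℕ) (h : a + b = n) (y : (CS A W₀).homology (a : ℤ)) (z : (CS A W₀).homology (b : ℤ)) :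
    rT A U W₀ W hW n (cupS A W₀ a b n h y z) = cupT A W a b n h (rT A U W₀ W hW a y) (rT A U W₀ W hW b z) :=
  homologyMap_refineComplexMap_cupH _ _ _ _ (AbelianSchemeOver.monotone_indexMap_refine) _ _
    (pullbackSystemHom_mulPairing _ _ _ _ _ _ _ _) a b n h y z

omit [Fintype ι] in
/-- `i₁^*` is multiplicative. [cite: MumfordAV1970, §13 Cor. 2 (p. 129)] -/
theorem iOne_mul (a b n : ℕ) (h : a + b = n) (y : (CS A W₀).homology (a : ℤ)) (z : (CS A W₀).homology (b : ℤ)) :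
    iOne A U W₀ hW₀ j₀ hj₀ n (cupS A W₀ a b n h y z) =
      cupA A U a b n h (iOne A U W₀ hW₀ j₀ hj₀ a y) (iOne A U W₀ hW₀ j₀ hj₀ b z) :=
  homologyMap_refineComplexMap_cupH _ _ _ _ (AbelianSchemeOver.monotone_indexMap_unitLeft j₀) _ _
    (pullbackSystemHom_mulPairing _ _ _ _ _ _ _ _) a b n h y z

omit [Fintype ι] in
/-- `i₂^*` is multiplicative. [cite: MumfordAV1970, §13 Cor. 2 (p. 129)] -/
theorem iTwo_mul (a b n : ℕ) (h : a + b = n) (y : (CS A W₀).homology (a : ℤ)) (z : (CS A W₀).homology (b : ℤ)) :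
    iTwo A U W₀ hW₀ j₀ hj₀ n (cupS A W₀ a b n h y z) =
      cupA A U a b n h (iTwo A U W₀ hW₀ j₀ hj₀ a y) (iTwo A U W₀ hW₀ j₀ hj₀ b z) :=
  homologyMap_refineComplexMap_cupH _ _ _ _ (AbelianSchemeOver.monotone_indexMap_unitRight j₀) _ _
    (pullbackSystemHom_mulPairing _ _ _ _ _ _ _ _) a b n h y z

include hcov in
/-- (G1-a, non-monotone) via ★ `Modules/CechRefineMultiplicative.homologyMap_cupH` (p01). [cite: MumfordAV1970, §13 Cor. 2 (p. 129)] -/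
theorem pTwo_mul (a b n : ℕ) (h : a + b = n) (y : (CA A U).homology (a : ℤ)) (z : (CA A U).homology (b : ℤ)) :
    pTwo A U W₀ hW₀ n (cupA A U a b n h y z) = cupS A W₀ a b n h (pTwo A U W₀ hW₀ a y) (pTwo A U W₀ hW₀ b z) :=
  homologyMap_cupH (U' A U) (unitModule A.X.left) (ρ₁ A) (mulPairing (U' A U) (ρ₁ A)) (mulPairing (W₀' A W₀) (ρ₂ A))
    (fun c => (ofLex c).2) (φp₂ A U W₀ hW₀) (φp₂ A U W₀ hW₀) (φp₂ A U W₀ hW₀) (hUa A U) hcov IsAffineLocalizing.unit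
    (isNaturalPairing_mulPairing _ _) (isNaturalPairing_mulPairing _ _) (pullbackSystemHom_mulPairing _ _ _ _ _ _ _ _)
    (refineComplexMap _ (φp₂ A U W₀ hW₀)) (fun _ _ => rfl) (refineComplexMap _ (φp₂ A U W₀ hW₀)) (fun _ _ => rfl)
    (refineComplexMap _ (φp₂ A U W₀ hW₀)) (fun _ _ => rfl) a b n h y z

include hcov in
/-- `m_T^*` is multiplicative. [cite: MumfordAV1970, §13 Cor. 2 (p. 129)] -/
theorem mT_mul (a b n : ℕ) (h : a + b = n) (y : (CA A U).homology (a : ℤ)) (z : (CA A U).homology (b : ℤ)) :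
    mT A U W₀ W hW n (cupA A U a b n h y z) = cupT A W a b n h (mT A U W₀ W hW a y) (mT A U W₀ W hW b z) :=
  homologyMap_cupH (U' A U) (unitModule A.X.left) (ρ₁ A) (mulPairing (U' A U) (ρ₁ A)) (mulPairing (W' A W) (ρ₂ A))
    (fun d => (ofLex d).2) (φm A U W₀ W hW) (φm A U W₀ W hW) (φm A U W₀ W hW) (hUa A U) hcov IsAffineLocalizing.unit
    (isNaturalPairing_mulPairing _ _) (isNaturalPairing_mulPairing _ _) (pullbackSystemHom_mulPairing _ _ _ _ _ _ _ _)
    (refineComplexMap _ (φm A U W₀ W hW)) (fun _ _ => rfl) (refineComplexMap _ (φm A U W₀ W hW)) (fun _ _ => rfl)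
    (refineComplexMap _ (φm A U W₀ W hW)) (fun _ _ => rfl) a b n h y z

include hcov hW₀ in
/-- `sw^*` is multiplicative. [cite: MumfordAV1970, §13 Cor. 2 (p. 129)] -/
theorem swS_mul (a b n : ℕ) (h : a + b = n) (y : (CS A W₀).homology (a : ℤ)) (z : (CS A W₀).homology (b : ℤ)) :
    swS A U W₀ hW₀ n (cupS A W₀ a b n h y z) = cupS A W₀ a b n h (swS A U W₀ hW₀ a y) (swS A U W₀ hW₀ b z) :=
  homologyMap_cupH (W₀' A W₀) (unitModule (X2 A)) (ρ₂ A) (mulPairing (W₀' A W₀) (ρ₂ A)) (mulPairing (W₀' A W₀) (ρ₂ A))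
    (fun c => toLex ((ofLex c).2, (ofLex c).1)) (φsw A U W₀ hW₀) (φsw A U W₀ hW₀) (φsw A U W₀ hW₀) (hW₀a A W₀)
    (hW₀cov A U hcov W₀ hW₀) IsAffineLocalizing.unit (isNaturalPairing_mulPairing _ _) (isNaturalPairing_mulPairing _ _)
    (pullbackSystemHom_mulPairing _ _ _ _ _ _ _ _) (refineComplexMap _ (φsw A U W₀ hW₀)) (fun _ _ => rfl)
    (refineComplexMap _ (φsw A U W₀ hW₀)) (fun _ _ => rfl) (refineComplexMap _ (φsw A U W₀ hW₀)) (fun _ _ => rfl)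
    a b n h y z

include hcov hW₀ in
/-- `m^*` is multiplicative. [cite: MumfordAV1970, §13 Cor. 2 (p. 129)] -/
theorem mS_mul (a b n : ℕ) (h : a + b = n) (y : (CA A U).homology (a : ℤ)) (z : (CA A U).homology (b : ℤ)) :
    mS A U hcov W₀ hW₀ W hW n (cupA A U a b n h y z) =
      cupS A W₀ a b n h (mS A U hcov W₀ hW₀ W hW a y) (mS A U hcov W₀ hW₀ W hW b z) := by
  apply (rT_bijective A U hcov W₀ hW₀ W hW n).1
  have hr : ∀ (j : ℕ) (w : (CT A W).homology (j : ℤ)),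
      rT A U W₀ W hW j ((LinearEquiv.ofBijective (rT A U W₀ W hW j) (rT_bijective A U hcov W₀ hW₀ W hW j)).symm w) =
        w := fun j w =>
    (LinearEquiv.ofBijective (rT A U W₀ W hW j) (rT_bijective A U hcov W₀ hW₀ W hW j)).apply_symm_apply w
  change rT A U W₀ W hW n ((LinearEquiv.ofBijective (rT A U W₀ W hW n)
    (rT_bijective A U hcov W₀ hW₀ W hW n)).symm (mT A U W₀ W hW n _)) = _
  rw [hr, mT_mul A U hcov W₀ W hW, rT_mul]
  change _ = cupT A W a b n h
    (rT A U W₀ W hW a ((LinearEquiv.ofBijective (rT A U W₀ W hW a) (rT_bijective A U hcov W₀ hW₀ W hW a)).symm _))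
    (rT A U W₀ W hW b ((LinearEquiv.ofBijective (rT A U W₀ W hW b) (rT_bijective A U hcov W₀ hW₀ W hW b)).symm _))
  rw [hr, hr]

/-! ### units -/

section Units

variable (eA : (CA A U).cycles ((0 : ℕ) : ℤ)) (eS : (CS A W₀).cycles ((0 : ℕ) : ℤ))
  (heA : ((CA A U).iCycles _).hom eA = (fun σ => unitFamily (U' A U) (ρ₁ A) σ.1 : SysCochain _ ((0 : ℕ) : ℤ)))
  (heS : ((CS A W₀).iCycles _).hom eS = (fun σ => unitFamily (W₀' A W₀) (ρ₂ A) σ.1 : SysCochain _ ((0 : ℕ) : ℤ)))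

omit [Fintype ι] in
include heA heS in
/-- `p₁^* [1] = [1]`. [cite: MumfordAV1970, §13 Cor. 2 (p. 129)] -/
theorem pOne_one : pOne A U W₀ hW₀ 0 (((CA A U).homologyπ _).hom eA) = ((CS A W₀).homologyπ _).hom eS :=
  homologyMap_refineComplexMap_unit _ _ (unitFamily _ _) (unitFamily _ _) (pullbackSystemHom_unitFamily _ _ _ _ _ _ _ _)
    eA heA eS heS

omit [Fintype ι] in
include heA heS in
/-- `p₂^* [1] = [1]`. [cite: MumfordAV1970, §13 Cor. 2 (p. 129)] -/
theorem pTwo_one : pTwo A U W₀ hW₀ 0 (((CA A U).homologyπ _).hom eA) = ((CS A W₀).homologyπ _).hom eS :=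
  homologyMap_refineComplexMap_unit _ _ (unitFamily _ _) (unitFamily _ _) (pullbackSystemHom_unitFamily _ _ _ _ _ _ _ _)
    eA heA eS heS

include hcov hW₀ heA heS in
/-- `m^* [1] = [1]`. [cite: MumfordAV1970, §13 Cor. 2 (p. 129)] -/
theorem mS_one : mS A U hcov W₀ hW₀ W hW 0 (((CA A U).homologyπ _).hom eA) = ((CS A W₀).homologyπ _).hom eS := by
  obtain ⟨eT, heT⟩ := exists_unitCycle (W' A W) (ρ₂ A)
  have hm : mT A U W₀ W hW 0 (((CA A U).homologyπ _).hom eA) = ((CT A W).homologyπ _).hom eT :=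
    homologyMap_refineComplexMap_unit _ _ (unitFamily _ _) (unitFamily _ _)
      (pullbackSystemHom_unitFamily _ _ _ _ _ _ _ _) eA heA eT heT
  have hr : rT A U W₀ W hW 0 (((CS A W₀).homologyπ _).hom eS) = ((CT A W).homologyπ _).hom eT :=
    homologyMap_refineComplexMap_unit _ _ (unitFamily _ _) (unitFamily _ _)
      (pullbackSystemHom_unitFamily _ _ _ _ _ _ _ _) eS heS eT heT
  change (LinearEquiv.ofBijective (rT A U W₀ W hW 0) (rT_bijective A U hcov W₀ hW₀ W hW 0)).symm
    (mT A U W₀ W hW 0 _) = _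
  rw [LinearEquiv.symm_apply_eq, hm, LinearEquiv.ofBijective_apply, hr]

end Units

end Assembly

end Literature.AlgebraicGeometry.AbelianSchemes.AbelianVarietyCech

end
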